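import Literature.NumberTheory.Sieve.MontgomeryVaughan1975DensityProofs
import HarnessLib

/-!
# Montgomery–Vaughan 1975: the major-arc formulae at EVERY small Page constant `c₁`, PROVED

Topic `Literature/NumberTheory/Sieve`, namespace `Literature.NumberTheory.Sieve.MontgomeryVaughan1975`
(continuation of `MontgomeryVaughan1975ErrorTerms.lean`, `MontgomeryVaughan1975Lemma43.lean`,
`MontgomeryVaughan1975DensityProofs.lean`).

The tree's PROVED `majorArc_formulae_holds : majorArc_formulae` packages the Page/Lemma-4.1 constant as
`∃ c₁ > 0, …` [MontgomeryVaughanActa1975, §6 (6.17), (6.1͂7), §7 (7.1), (7.͂1)].  Both inputs of its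
proof are available at every small `c₁`: `section6_formulae_holds c₁` (every `c₁`) and
`section7_errorBounds_of_lemma43_gallagher lemma43_gallagher_holds : ∃ c > 0, ∀ 0 < c₁ < c,
section7_errorBounds c₁`; and the insertion `majorArc_formulae_of_sections` keeps `c₁`.  This file
records the formulae with the constant EXPOSED — for every `c₁` below an absolute `c` — which is what a
consumer needs who must compare exceptional characters ACROSS levels by Page's theorem with a constant
`≥ 4c₁` (the parity-ideate route `LinnikGallagherMV`, crux «PointwiseMajorArcsMV», piece
`MajorArcFormulaeAtSmall` — VERBATIM `majorArc_formulae_forall_small` below).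

* `majorArc_formulae_at_of_sections` — `section6_formulae c₁ → section7_errorBounds c₁ →` (the body of
  `majorArc_formulae` at this `c₁`); the proof is that of `majorArc_formulae_of_sections` verbatim with the
  first witness dropped.
* `majorArc_formulae_forall_small` — `∃ c > 0, ∀ c₁ ∈ (0, c)`, the formulae at `c₁`.

No new facts.  Written for the parity-ideate cell (literature seat g15, 2026-08-27).

## References

* [MontgomeryVaughanActa1975] H. L. Montgomery, R. C. Vaughan, *The exceptional set in Goldbach's
  problem*, Acta Arith. 27 (1975) 353–370: §4 Lemma 4.1 (the constant `c₁`), §6 (6.17), (6.1͂7), §7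
  (7.1), (7.͂1), §8 (8.4).

## Mathlib / tree search

Tree: `majorArc_formulae`, `majorArc_formulae_of_sections`, `insert_bound`, `insert_i`, `insert_ii`,
`errTotal_nonneg`, `errTotalExc_nonneg` (`MontgomeryVaughan1975ErrorTerms`);
`section7_errorBounds_of_lemma43_gallagher` (`…Lemma43`); `lemma43_gallagher_holds`,
`section6_formulae_holds` (`…DensityProofs`, `…Section6ExcMain`). `lean search 'majorArc_formulae_forall|formulae_at'`:
nothing before this file.
-/

noncomputable section

open Finset MeasureTheory Filter

namespace Literature.NumberTheory.Sieve.MontgomeryVaughan1975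

/-- **(6.17), (6.1͂7) with (7.1), (7.͂1) inserted, AT A GIVEN `c₁`** (the body of `majorArc_formulae`
with its first witness fixed): `section6_formulae c₁ → section7_errorBounds c₁ →` the major-arc formulae
at the Page constant `c₁`.  Proof = `majorArc_formulae_of_sections` verbatim.
[cite: MontgomeryVaughanActa1975, §6 (6.17), (6.17~), §7 (7.1), (7.1~) and §8 (8.4)] -/
theorem majorArc_formulae_at_of_sections {c₁ : ℝ} (hc₁ : 0 < c₁) (h6 : section6_formulae c₁)
    (h7 : section7_errorBounds c₁) :
    ∃ c₆ : ℝ, 0 < c₆ ∧ ∃ C : ℝ, 0 < C ∧ ∃ δ₀ : ℝ, 0 < δ₀ ∧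
      ∀ δ : ℝ, 0 < δ → δ ≤ δ₀ → ∃ X₀ : ℝ, ∀ X : ℝ, X₀ ≤ X →
        Lemma41At c₁ (X ^ (6 * δ)) ∧
        ((∀ (r : ℕ) [NeZero r] (χ : DirichletCharacter ℂ r) (β : ℝ),
              ¬ IsExceptionalZero c₁ (X ^ (6 * δ)) r χ β) →
          ∀ n : ℕ, 1 ≤ n → (n : ℝ) ≤ X →
            ‖majorArcIntegral (X ^ (6 * δ)) (X ^ (1 - 6 * δ)) X n -
                ((goldbachSingularSeries n * n : ℝ) : ℂ)‖ ≤
              C * (X ^ (1 + δ) * (X ^ (6 * δ))⁻¹ +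
                (n : ℝ) / (Nat.totient n : ℝ) * X * Real.exp (-(c₆ / δ)))) ∧
        (∀ (r : ℕ) [NeZero r] (χ : DirichletCharacter ℂ r) (β : ℝ),
            IsExceptionalZero c₁ (X ^ (6 * δ)) r χ β →
          ∀ n : ℕ, 1 ≤ n → (n : ℝ) ≤ X → Even n →
            ‖majorArcIntegral (X ^ (6 * δ)) (X ^ (1 - 6 * δ)) X n -
                ((goldbachSingularSeries n *
                    (n + excRatio χ n * excPairSum (X ^ (6 * δ)) X β n) : ℝ) : ℂ)‖ ≤
              C * ((if n.Coprime r then (r : ℝ) * n * X / ((Nat.totient r : ℝ) ^ 2 * Nat.totient n)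
                    else 0) +
                X ^ (1 + δ) * (X ^ (6 * δ))⁻¹ * Nat.gcd n r +
                (n : ℝ) / (Nat.totient n : ℝ) * X * ((1 - β) * Real.log (X ^ (6 * δ))) *
                  Real.exp (-(c₆ / δ)))) := by
  obtain ⟨C₆, hC₆, δ₆, hδ₆, H6⟩ := h6
  obtain ⟨c₆, hc₆, C₇, hC₇, δ₇, hδ₇, H7⟩ := h7
  set K : ℝ := C₇ + C₇ ^ 2 * (1 + c₁) with hK
  have hK0 : 0 ≤ K := by positivity
  refine ⟨c₆, hc₆, C₆ * (1 + K), by positivity, min δ₆ δ₇, lt_min hδ₆ hδ₇,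
    fun δ hδ hδle => ?_⟩
  obtain ⟨X₆, hX₆⟩ := H6 δ hδ (hδle.trans (min_le_left _ _))
  obtain ⟨X₇, hX₇⟩ := H7 δ hδ (hδle.trans (min_le_right _ _))
  -- threshold: `c₁ < log P` (so that an exceptional `β` is positive) and `X ≥ 1`
  have hev : ∀ᶠ X : ℝ in atTop, c₁ < Real.log (X ^ (6 * δ)) ∧ 1 ≤ X := by
    have h1 := (Real.tendsto_log_atTop.comp (tendsto_rpow_atTop (by linarith : 0 < 6 * δ))).eventually_gt_atTop c₁
    filter_upwards [h1, eventually_ge_atTop (1 : ℝ)] with X hX hX1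
    exact ⟨hX, hX1⟩
  obtain ⟨X₈, hX₈⟩ := Filter.eventually_atTop.mp hev
  refine ⟨max (max X₆ X₇) X₈, fun X hX => ?_⟩
  have hXX₆ : X₆ ≤ X := ((le_max_left _ _).trans (le_max_left _ _)).trans hX
  have hXX₇ : X₇ ≤ X := ((le_max_right _ _).trans (le_max_left _ _)).trans hX
  obtain ⟨hlogP, hX1⟩ := hX₈ X ((le_max_right _ _).trans hX)
  have hX0 : 0 ≤ X := zero_le_one.trans hX1
  obtain ⟨h6a, h6b⟩ := hX₆ X hXX₆
  obtain ⟨h41, h7a, h7b⟩ := hX₇ X hXX₇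
  set P : ℝ := X ^ (6 * δ) with hP
  set Q : ℝ := X ^ (1 - 6 * δ) with hQ
  set ε : ℝ := Real.exp (-(c₆ / δ)) with hε
  have hε0 : 0 ≤ ε := (Real.exp_pos _).le
  have hε1 : ε ≤ 1 := by rw [hε, Real.exp_le_one_iff]; exact neg_nonpos.mpr (div_nonneg hc₆.le hδ.le)
  have hlogP0 : 0 < Real.log P := lt_trans hc₁ hlogP
  refine ⟨h41, fun hno n hn1 hnX => ?_, fun r _ χ β hEZ n hn1 hnX heven => ?_⟩
  · -- (i): insert (7.1) into (6.17)
    have hW := h7a hno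
    have hW0 := errTotal_nonneg P Q X
    have hins := insert_bound hW0 hW hX0 hε0 hε1
    have ht : 0 ≤ (n : ℝ) / (Nat.totient n : ℝ) := by positivity
    have hE0 : 0 ≤ X ^ (1 + δ) * P⁻¹ := by
      have : 0 ≤ P := by rw [hP]; exact Real.rpow_nonneg hX0 _
      positivity
    have hK' : C₇ + C₇ ^ 2 ≤ 1 + K := by rw [hK]; nlinarith [sq_nonneg C₇]
    exact insert_i (h6a n hn1 hnX) hins hK' hC₆.le ht hE0 hX0 hε0 hK0
  · -- (ii): insert (7.1~) into (6.17~)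
    have hquad : χ ^ 2 = 1 := h41.1 r χ β hEZ
    have hW := h7b r χ β hEZ
    have hEZ' := hEZ
    obtain ⟨hprim, hne, hrP, hβlo, hβ1, _⟩ := hEZ'
    have hβ0 : 0 < β := by
      have : c₁ / Real.log P < 1 := (div_lt_one hlogP0).mpr hlogP
      linarith
    set L : ℝ := (1 - β) * Real.log P with hL
    have hL0 : 0 ≤ L := mul_nonneg (by linarith) hlogP0.le
    have hLc : L ≤ c₁ := by
      have h1 : 1 - β ≤ c₁ / Real.log P := by linarith
      calc L = (1 - β) * Real.log P := rfl
        _ ≤ c₁ / Real.log P * Real.log P := mul_le_mul_of_nonneg_right h1 hlogP0.le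
        _ = c₁ := div_mul_cancel₀ c₁ hlogP0.ne'
    set W := errTotalExc P Q X χ β with hWdef
    have hW0 : 0 ≤ W := errTotalExc_nonneg P Q X χ β
    -- `W ≤ (C₇ L) X^{1/2} ε`, hence `X^{1/2} W + W² ≤ (C₇ L + (C₇ L)²) X ε ≤ (C₇ + C₇² c₁) X L ε`
    have hW' : W ≤ (C₇ * L) * X ^ (1 / 2 : ℝ) * ε := by
      calc W ≤ C₇ * X ^ (1 / 2 : ℝ) * L * ε := hW
        _ = (C₇ * L) * X ^ (1 / 2 : ℝ) * ε := by ring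
    have hins := insert_bound hW0 hW' hX0 hε0 hε1
    have hins' : X ^ (1 / 2 : ℝ) * W + W ^ 2 ≤ (C₇ + C₇ ^ 2 * c₁) * X * L * ε := by
      have h1 : (C₇ * L + (C₇ * L) ^ 2) * X * ε ≤ (C₇ + C₇ ^ 2 * c₁) * X * L * ε := by
        have : (C₇ * L + (C₇ * L) ^ 2) ≤ (C₇ + C₇ ^ 2 * c₁) * L := by
          have : C₇ ^ 2 * L * L ≤ C₇ ^ 2 * c₁ * L := by
            have := mul_le_mul_of_nonneg_left hLc (by positivity : 0 ≤ C₇ ^ 2 * L)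
            linarith
          nlinarith
        calc (C₇ * L + (C₇ * L) ^ 2) * X * ε = (C₇ * L + (C₇ * L) ^ 2) * (X * ε) := by ring
          _ ≤ (C₇ + C₇ ^ 2 * c₁) * L * (X * ε) := mul_le_mul_of_nonneg_right this (by positivity)
          _ = _ := by ring
      calc X ^ (1 / 2 : ℝ) * W + W ^ 2 = W * X ^ (1 / 2 : ℝ) + W ^ 2 := by ring
        _ ≤ (C₇ * L + (C₇ * L) ^ 2) * X * ε := hins
        _ ≤ _ := h1
    have ht : 0 ≤ (n : ℝ) / (Nat.totient n : ℝ) := by positivity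
    have hE₁0 : 0 ≤ (if n.Coprime r then (r : ℝ) * n * X / ((Nat.totient r : ℝ) ^ 2 * Nat.totient n)
        else 0) := by split_ifs <;> positivity
    have hE₂0 : 0 ≤ X ^ (1 + δ) * P⁻¹ * (Nat.gcd n r : ℝ) := by
      have : 0 ≤ P := by rw [hP]; exact Real.rpow_nonneg hX0 _
      positivity
    have hK' : C₇ + C₇ ^ 2 * c₁ ≤ 1 + K := by rw [hK]; nlinarith [sq_nonneg C₇, hC₇.le]
    have h6bn := h6b r χ β hEZ hquad n hn1 hnX heven
    exact insert_ii h6bn hins' hK' hC₆.le ht hE₁0 hE₂0 hX0 hL0 hε0 hK0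

/-- **The major-arc formulae of Montgomery–Vaughan 1975 at every small Page constant**: there is an
absolute `c > 0` such that for every `0 < c₁ < c` the formulae (6.17)/(7.1) and (6.1͂7)/(7.͂1) hold at
level `P = X^{6δ}` with `c₁`-exceptional zeros (Lemma 4.1 at `c₁`), for all `0 < δ ≤ δ₀(c₁)` and
`X ≥ X₀(c₁, δ)` — VERBATIM the piece `MajorArcFormulaeAtSmall` of the parity-ideate route
`LinnikGallagherMV` (crux «PointwiseMajorArcsMV»).  From `lemma43_gallagher_holds` (every small `c₁`),
`section6_formulae_holds c₁` and `majorArc_formulae_at_of_sections`.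
[cite: MontgomeryVaughanActa1975, §4 Lemma 4.1, §6 (6.17), (6.17~), §7 (7.1), (7.1~)] -/
theorem majorArc_formulae_forall_small :
    ∃ c : ℝ, 0 < c ∧ ∀ c₁ : ℝ, 0 < c₁ → c₁ < c →
      ∃ c₆ : ℝ, 0 < c₆ ∧ ∃ C : ℝ, 0 < C ∧ ∃ δ₀ : ℝ, 0 < δ₀ ∧
        ∀ δ : ℝ, 0 < δ → δ ≤ δ₀ → ∃ X₀ : ℝ, ∀ X : ℝ, X₀ ≤ X →
          Lemma41At c₁ (X ^ (6 * δ)) ∧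
          (((∀ (r : ℕ) [NeZero r] (χ : DirichletCharacter ℂ r) (β : ℝ),
                ¬ IsExceptionalZero c₁ (X ^ (6 * δ)) r χ β) →
            ∀ n : ℕ, 1 ≤ n → (n : ℝ) ≤ X →
              ‖majorArcIntegral (X ^ (6 * δ)) (X ^ (1 - 6 * δ)) X n - ((goldbachSingularSeries n * n : ℝ) : ℂ)‖ ≤
                C * (X ^ (1 + δ) * (X ^ (6 * δ))⁻¹ +
                  (n : ℝ) / (Nat.totient n : ℝ) * X * Real.exp (-(c₆ / δ))))) ∧
          (∀ (r : ℕ) [NeZero r] (χ : DirichletCharacter ℂ r) (β : ℝ),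
              IsExceptionalZero c₁ (X ^ (6 * δ)) r χ β →
            ∀ n : ℕ, 1 ≤ n → (n : ℝ) ≤ X → Even n →
              ‖majorArcIntegral (X ^ (6 * δ)) (X ^ (1 - 6 * δ)) X n -
                  ((goldbachSingularSeries n * (n + excRatio χ n * excPairSum (X ^ (6 * δ)) X β n) : ℝ) : ℂ)‖ ≤
                C * ((if n.Coprime r then (r : ℝ) * n * X / ((Nat.totient r : ℝ) ^ 2 * Nat.totient n) else 0) +
                  X ^ (1 + δ) * (X ^ (6 * δ))⁻¹ * Nat.gcd n r +
                  (n : ℝ) / (Nat.totient n : ℝ) * X * ((1 - β) * Real.log (X ^ (6 * δ))) * Real.exp (-(c₆ / δ)))) := by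
  obtain ⟨c, hc, h7⟩ := section7_errorBounds_of_lemma43_gallagher lemma43_gallagher_holds
  exact ⟨c, hc, fun c₁ hc₁ hlt =>
    majorArc_formulae_at_of_sections hc₁ (section6_formulae_holds c₁) (h7 c₁ hc₁ hlt)⟩

end Literature.NumberTheory.Sieve.MontgomeryVaughan1975

end
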